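import Summits.Ventures.PercRepro.Night2FatZLarge

/-!
# night-2: the two-planes regime — a basis pair with two basis points on the spine, every `N`

In the non-degenerate two-planes regime a lossy basis pair with two basis points `a, b` on the spine has its other two
basis points in different planes off the spine, at least two points of `W ∖ {x}` in each plane off the spine (each plane
has `≥ 3` points off the spine, one of them a basis point), at least one point of `W ∖ {x}` on the spine, hence `N ≥ 6`,
a three-point spine at `N = 6` and a spine of at most four points at `N = 7`.  So
`basis_pair_fair_fat_of_two_planes_six` / `_seven` / `_of_eight_le` give the fair share:
**`basis_pair_fair_fat_of_two_planes_of_two_basis_points`**.  With `basis_pair_fair_fat_of_two_planes_of_no_basis_point`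
(no basis point on the spine) the non-degenerate regime is closed for every lossy basis pair except those with EXACTLY ONE
basis point on the spine (§6 (b) of the paper).  Paper `proofs/NIGHT-2-g34.md` §6 (c).
-/

namespace PercRepro.Shadow

open PercRepro.ThmH PercRepro.PerFlat

variable {α : Type*} [DecidableEq α] {M : Matroid α} [M.Finite] {G : Finset α}

/-- **Two basis points on the spine: the fair share for every `N`** (non-degenerate two-planes regime). -/
theorem basis_pair_fair_fat_of_two_planes_of_two_basis_points (hG : G ∈ flatsQ M (5 + 1))
    (hd : (gr M \ G).card = 2) (hk : kColoops M G = 1)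
    (hs : ∀ e ∈ gr M, ∀ f ∈ gr M, e ≠ f → rkN M {e, f} = 2) (hl : ∀ e ∈ gr M, M.Indep {e})
    (hfat : (fatClosures M 5 G 2).card ≤ 1)
    {B₀ : Finset α} (hB₀ : B₀ ∈ thinMembers M 5 G) {w₀ x : α} (hD : G \ clF M B₀ = {w₀, x}) (hne : w₀ ≠ x)
    {R₁ : Finset α}
    (hR₁V : R₁ ⊆ (G \ coloops M G) \ {w₀, x}) (hR₁2 : rkN M R₁ = 2) (hR₁3 : 3 ≤ R₁.card) {c₂ c₃ : α}
    (hc₂V : c₂ ∈ (G \ coloops M G) \ {w₀, x}) (hc₃V : c₃ ∈ (G \ coloops M G) \ {w₀, x})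
    (hc₂ : c₂ ∉ clF M R₁) (hc₃ : c₃ ∉ clF M (insert c₂ R₁))
    (hcover : ∀ e ∈ (G \ coloops M G) \ {w₀, x}, e ∈ clF M (insert c₂ R₁) ∨ e ∈ clF M (insert c₃ R₁))
    (hnd₂ : 3 ≤ rkN M (((G \ coloops M G) \ {w₀, x}).filter
      (fun e => e ∈ clF M (insert c₂ R₁) ∧ e ∉ clF M R₁)))
    (hnd₃ : 3 ≤ rkN M (((G \ coloops M G) \ {w₀, x}).filter
      (fun e => e ∈ clF M (insert c₃ R₁) ∧ e ∉ clF M R₁)))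
    {B : Finset α} (hB : B ∈ thinMembers M 5 G) (hnP : ¬ bigP M G B) {z : α} (hz : z ∈ G \ clF M B)
    (hl0 : loss M 5 G B z ≠ 0) (hw₀ : w₀ ∈ insert z B) (hx : x ∉ insert z B) {a b : α}
    (ha : a ∈ (insert z B \ coloops M G).erase w₀) (hb : b ∈ (insert z B \ coloops M G).erase w₀) (hab : a ≠ b)
    (haL : a ∈ clF M R₁) (hbL : b ∈ clF M R₁) :
    loss M 5 G B z ≤ rhoL M 5 G B z * lossIncomeH M 5 G (bigP M G) (dshGT2 M 5 G) B z := by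
  have hd' : (gr M \ G).card ≤ 5 := by omega
  have hGg : G ⊆ gr M := (mem_flatsQ.1 hG).1
  have hQG : insert z B ⊆ G :=
    Finset.insert_subset (Finset.mem_sdiff.1 hz).1 (subset_G_of_mem_thinMembers hB)
  have hKQ : coloops M G ⊆ insert z B :=
    (coloops_subset_of_mem_thinMembers hG hd' hB).trans (Finset.subset_insert _ _)
  have hxG : x ∈ G \ insert z B := by
    refine Finset.mem_sdiff.2 ⟨?_, hx⟩
    have : x ∈ G \ clF M B₀ := by
      rw [hD]
      exact Finset.mem_insert_of_mem (Finset.mem_singleton_self _)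
    exact (Finset.mem_sdiff.1 this).1
  have hVg : (G \ coloops M G) \ {w₀, x} ⊆ gr M := fun e he =>
    hGg (Finset.mem_sdiff.1 (Finset.mem_sdiff.1 he).1).1
  have hR₁g : R₁ ⊆ gr M := hR₁V.trans hVg
  have hc₂g : c₂ ∈ gr M := hVg hc₂V
  have hc₃g : c₃ ∈ gr M := hVg hc₃V
  set W' := (G \ insert z B).erase x with hW'
  set P₀ := (insert z B \ coloops M G).erase w₀ with hP₀
  set V' := (G \ coloops M G) \ {w₀, x} with hV'
  -- `H₀ = W' ∪ P₀`
  have hW'V : W' ⊆ V' := by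
    intro e he
    rw [hW', Finset.mem_erase, Finset.mem_sdiff] at he
    rw [hV', Finset.mem_sdiff, Finset.mem_sdiff, Finset.mem_insert, Finset.mem_singleton]
    refine ⟨⟨he.2.1, fun h' => he.2.2 (hKQ h')⟩, ?_⟩
    rintro (rfl | rfl)
    · exact he.2.2 hw₀
    · exact he.1 rfl
  have hP₀V : P₀ ⊆ V' := by
    intro e he
    rw [hP₀, Finset.mem_erase, Finset.mem_sdiff] at he
    rw [hV', Finset.mem_sdiff, Finset.mem_sdiff, Finset.mem_insert, Finset.mem_singleton]
    refine ⟨⟨hQG he.2.1, he.2.2⟩, ?_⟩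
    rintro (rfl | rfl)
    · exact he.1 rfl
    · exact hx he.2.1
  have hVW : ∀ e ∈ V', e ∈ W' ∨ e ∈ P₀ := by
    intro e he
    rw [hV', Finset.mem_sdiff, Finset.mem_sdiff, Finset.mem_insert, Finset.mem_singleton, not_or] at he
    by_cases heQ : e ∈ insert z B
    · right
      rw [hP₀, Finset.mem_erase, Finset.mem_sdiff]
      exact ⟨he.2.1, heQ, he.1.2⟩
    · left
      rw [hW', Finset.mem_erase, Finset.mem_sdiff]
      exact ⟨he.2.2, he.1.1, heQ⟩
  have hWP : Disjoint W' P₀ := by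
    rw [Finset.disjoint_left]
    intro e he₁ he₂
    rw [hW', Finset.mem_erase, Finset.mem_sdiff] at he₁
    rw [hP₀, Finset.mem_erase, Finset.mem_sdiff] at he₂
    exact he₁.2.2 he₂.2.1
  -- `P₀` is independent with four points
  have hQ5 := card_insert_sdiff_eq_five hG hd hk hB hnP hz
  have hrk5 := rkN_insert_sdiff_coloops_eq_five_of_thin hG hd hk hB hz
  have hind : M.Indep ((insert z B \ coloops M G : Finset α) : Set α) :=
    indep_of_rkN_eq_card (by rw [hrk5, hQ5])
  have hP₀ind : M.Indep (P₀ : Set α) := hind.subset (by exact_mod_cast (Finset.erase_subset _ _))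
  have hw₀K : w₀ ∉ coloops M G := by
    intro h'
    have h1 : w₀ ∈ clF M B₀ := subset_clF_of_subset_gr ((subset_G_of_mem_thinMembers hB₀).trans hGg)
      (coloops_subset_of_mem_thinMembers hG hd' hB₀ h')
    have h2 : w₀ ∈ G \ clF M B₀ := by
      rw [hD]
      exact Finset.mem_insert_self _ _
    exact (Finset.mem_sdiff.1 h2).2 h1
  have hP₀4 : P₀.card = 4 := by
    rw [hP₀, Finset.card_erase_of_mem (Finset.mem_sdiff.2 ⟨hw₀, hw₀K⟩), hQ5]
  -- an independent subset of a closure of rank `r` has at most `r` points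
  have hindep_card : ∀ S : Finset α, S ⊆ P₀ → ∀ X : Finset α, S ⊆ clF M X → S.card ≤ rkN M X := by
    intro S hS X hSX
    have := rkN_mono (M := M) hSX
    rw [rkN_clF, rkN_eq_card_of_indep (hP₀ind.subset (by exact_mod_cast hS))] at this
    exact this
  -- the basis points on the spine are exactly `a, b`
  have hP₀L : ∀ e ∈ P₀, e ∈ clF M R₁ → e = a ∨ e = b := by
    intro e he heL
    by_contra hne'
    rw [not_or] at hne'
    have hsub : ({a, b, e} : Finset α) ⊆ P₀ := by
      intro u hu
      rw [Finset.mem_insert, Finset.mem_insert, Finset.mem_singleton] at hu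
      rcases hu with rfl | rfl | rfl
      · exact ha
      · exact hb
      · exact he
    have hsubL : ({a, b, e} : Finset α) ⊆ clF M R₁ := by
      intro u hu
      rw [Finset.mem_insert, Finset.mem_insert, Finset.mem_singleton] at hu
      rcases hu with rfl | rfl | rfl
      · exact haL
      · exact hbL
      · exact heL
    have h := hindep_card _ hsub _ hsubL
    rw [hR₁2, Finset.card_insert_of_notMem, Finset.card_pair (fun h' => hne'.2 h'.symm)] at h
    · omega
    · rw [Finset.mem_insert, Finset.mem_singleton, not_or]
      exact ⟨hab, fun h' => hne'.1 h'.symm⟩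
  -- at most one basis point in each plane off the spine
  have hplane_le : ∀ c : α, c ∈ V' → c ∉ clF M R₁ → ∀ P : Finset α, P ⊆ P₀ →
      (∀ e ∈ P, e ∈ clF M (insert c R₁) ∧ e ∉ clF M R₁) → P.card ≤ 1 := by
    intro c hcV hcL P hPP₀ hP
    have hc' : c ∈ gr M := hVg hcV
    have hrk : rkN M (insert c R₁) = 3 := by rw [rkN_insert_of_notMem_clF hc' hcL, hR₁2]
    have hsub : {a, b} ∪ P ⊆ P₀ := by
      refine Finset.union_subset ?_ hPP₀
      intro u hu
      rw [Finset.mem_insert, Finset.mem_singleton] at hu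
      rcases hu with rfl | rfl
      · exact ha
      · exact hb
    have hsubc : {a, b} ∪ P ⊆ clF M (insert c R₁) := by
      refine Finset.union_subset ?_ (fun e he => (hP e he).1)
      intro u hu
      rw [Finset.mem_insert, Finset.mem_singleton] at hu
      have hmono := clF_mono (M := M) (Finset.subset_insert c R₁)
      rcases hu with rfl | rfl
      · exact hmono haL
      · exact hmono hbL
    have h := hindep_card _ hsub _ hsubc
    rw [hrk] at h
    have hdisj : Disjoint ({a, b} : Finset α) P := by
      rw [Finset.disjoint_left]
      intro u hu huP
      rw [Finset.mem_insert, Finset.mem_singleton] at hu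
      rcases hu with rfl | rfl
      · exact (hP _ huP).2 haL
      · exact (hP _ huP).2 hbL
    rw [Finset.card_union_of_disjoint hdisj, Finset.card_pair hab] at h
    omega
  -- the points of `W ∖ {x}` in each plane off the spine: at least two
  have hA2 : ∀ c : α, c ∈ V' → c ∉ clF M R₁ →
      3 ≤ rkN M (V'.filter (fun e => e ∈ clF M (insert c R₁) ∧ e ∉ clF M R₁)) →
      2 ≤ (W'.filter (fun e => e ∈ clF M (insert c R₁) ∧ e ∉ clF M R₁)).card := by
    intro c hcV hcL hrk
    have h3 : 3 ≤ (V'.filter (fun e => e ∈ clF M (insert c R₁) ∧ e ∉ clF M R₁)).card :=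
      le_trans hrk (rkN_le_card _)
    have hsplit : V'.filter (fun e => e ∈ clF M (insert c R₁) ∧ e ∉ clF M R₁) ⊆
        W'.filter (fun e => e ∈ clF M (insert c R₁) ∧ e ∉ clF M R₁) ∪
        P₀.filter (fun e => e ∈ clF M (insert c R₁) ∧ e ∉ clF M R₁) := by
      intro e he
      rw [Finset.mem_filter] at he
      rw [Finset.mem_union, Finset.mem_filter, Finset.mem_filter]
      rcases hVW e he.1 with h | h
      · exact Or.inl ⟨h, he.2⟩
      · exact Or.inr ⟨h, he.2⟩
    have h1 := Finset.card_le_card hsplit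
    have h2 := Finset.card_union_le (W'.filter (fun e => e ∈ clF M (insert c R₁) ∧ e ∉ clF M R₁))
      (P₀.filter (fun e => e ∈ clF M (insert c R₁) ∧ e ∉ clF M R₁))
    have h4 := hplane_le c hcV hcL _ (Finset.filter_subset _ _) (fun e he => (Finset.mem_filter.1 he).2)
    omega
  have hA := hA2 c₂ hc₂V hc₂ hnd₂
  have hBp := hA2 c₃ hc₃V (fun h' => hc₃ (clF_mono (Finset.subset_insert _ _) h')) hnd₃
  -- the spine points of `W ∖ {x}`: at least one
  set TL := W'.filter (fun e => e ∈ clF M R₁) with hTL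
  have hTL1 : 1 ≤ TL.card := by
    have hR₁sub : R₁ ⊆ TL ∪ {a, b} := by
      intro e he
      have heV := hR₁V he
      have heL : e ∈ clF M R₁ := subset_clF_of_subset_gr hR₁g he
      rw [Finset.mem_union, hTL, Finset.mem_filter, Finset.mem_insert, Finset.mem_singleton]
      rcases hVW e heV with h | h
      · exact Or.inl ⟨h, heL⟩
      · exact Or.inr (hP₀L e h heL)
    have h1 := Finset.card_le_card hR₁sub
    have h2 := Finset.card_union_le TL ({a, b} : Finset α)
    rw [Finset.card_pair hab] at h2
    omega
  -- the spine has `|TL| + 2` points of `H₀`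
  have hLcard : (V'.filter (fun e => e ∈ clF M R₁)).card = TL.card + 2 := by
    have heq : V'.filter (fun e => e ∈ clF M R₁) = TL ∪ {a, b} := by
      ext e
      rw [Finset.mem_filter, Finset.mem_union, hTL, Finset.mem_filter, Finset.mem_insert, Finset.mem_singleton]
      constructor
      · rintro ⟨heV, heL⟩
        rcases hVW e heV with h | h
        · exact Or.inl ⟨h, heL⟩
        · exact Or.inr (hP₀L e h heL)
      · rintro (⟨heW, heL⟩ | h)
        · exact ⟨hW'V heW, heL⟩
        · rcases h with rfl | rfl
          · exact ⟨hP₀V ha, haL⟩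
          · exact ⟨hP₀V hb, hbL⟩
    have hdisj : Disjoint TL ({a, b} : Finset α) := by
      rw [Finset.disjoint_left]
      intro e he₁ he₂
      rw [hTL, Finset.mem_filter] at he₁
      rw [Finset.mem_insert, Finset.mem_singleton] at he₂
      rcases he₂ with rfl | rfl
      · exact Finset.disjoint_left.1 hWP he₁.1 ha
      · exact Finset.disjoint_left.1 hWP he₁.1 hb
    rw [heq, Finset.card_union_of_disjoint hdisj, Finset.card_pair hab]
  -- `W' = TL ∪ A ∪ Bp`
  set A := W'.filter (fun e => e ∈ clF M (insert c₂ R₁) ∧ e ∉ clF M R₁) with hA'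
  set Bp := W'.filter (fun e => e ∈ clF M (insert c₃ R₁) ∧ e ∉ clF M R₁) with hBp'
  have hWcard : W'.card = TL.card + A.card + Bp.card := by
    have heq : W' = TL ∪ (A ∪ Bp) := by
      ext e
      rw [Finset.mem_union, Finset.mem_union, hTL, hA', hBp', Finset.mem_filter, Finset.mem_filter,
        Finset.mem_filter]
      constructor
      · intro he
        by_cases heL : e ∈ clF M R₁
        · exact Or.inl ⟨he, heL⟩
        · rcases hcover e (hW'V he) with h | h
          · exact Or.inr (Or.inl ⟨he, h, heL⟩)
          · exact Or.inr (Or.inr ⟨he, h, heL⟩)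
      · rintro (h | h | h) <;> exact h.1
    have hd1 : Disjoint TL (A ∪ Bp) := by
      rw [Finset.disjoint_left]
      intro e he₁ he₂
      rw [hTL, Finset.mem_filter] at he₁
      rw [Finset.mem_union, hA', hBp', Finset.mem_filter, Finset.mem_filter] at he₂
      rcases he₂ with h | h <;> exact h.2.2 he₁.2
    have hd2 : Disjoint A Bp := by
      rw [Finset.disjoint_left]
      intro e he₁ he₂
      rw [hA', Finset.mem_filter] at he₁
      rw [hBp', Finset.mem_filter] at he₂
      exact he₁.2.2 (mem_clF_of_mem_two_planes hR₁g hc₂g hc₃g hc₂ hc₃ he₁.2.1 he₂.2.1)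
    rw [heq, Finset.card_union_of_disjoint hd1, Finset.card_union_of_disjoint hd2]
    omega
  have hm : W'.card + 1 = (G \ insert z B).card := by
    rw [hW', Finset.card_erase_of_mem hxG]
    have : 0 < (G \ insert z B).card := Finset.card_pos.2 ⟨x, hxG⟩
    omega
  -- two points in each plane off the spine
  obtain ⟨y₂, y₂', hy₂, hy₂', hy₂y₂'⟩ := Finset.one_lt_card_iff.1 (by omega : 1 < A.card)
  obtain ⟨y₃, y₃', hy₃, hy₃', hy₃y₃'⟩ := Finset.one_lt_card_iff.1 (by omega : 1 < Bp.card)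
  rw [hA', Finset.mem_filter] at hy₂ hy₂'
  rw [hBp', Finset.mem_filter] at hy₃ hy₃'
  -- the case split on `N`
  rcases Nat.lt_or_ge (G \ insert z B).card 7 with h7 | h7
  · -- `N = 6`: `|TL| = 1`, the spine has three points
    have hN : (G \ insert z B).card = 6 := by omega
    have hL3 : (V'.filter (fun e => e ∈ clF M R₁)).card ≤ 3 := by omega
    exact basis_pair_fair_fat_of_two_planes_six hG hd hk hs hl hfat hB₀ hD hne hR₁V hR₁2 hR₁3 hc₂V hc₃V hc₂ hc₃
      hcover hnd₂ hnd₃ hL3 hB hnP hz hl0 hw₀ hx hN hy₂.1 hy₂'.1 hy₃.1 hy₃'.1 hy₂y₂' hy₃y₃' hy₂.2.1 hy₂.2.2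
      hy₂'.2.1 hy₂'.2.2 hy₃.2.1 hy₃.2.2 hy₃'.2.1 hy₃'.2.2
  rcases Nat.lt_or_ge (G \ insert z B).card 8 with h8 | h8
  · -- `N = 7`: `|TL| ≤ 2`, the spine has at most four points
    have hN : (G \ insert z B).card = 7 := by omega
    have hL4 : (V'.filter (fun e => e ∈ clF M R₁)).card ≤ 4 := by omega
    exact basis_pair_fair_fat_of_two_planes_seven hG hd hk hs hl hfat hB₀ hD hne hR₁V hR₁2 hR₁3 hc₂V hc₃V hc₂ hc₃
      hcover hnd₂ hnd₃ hL4 hB hnP hz hl0 hw₀ hx hN (by simp only [← hW', ← hA']; omega)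
      (by simp only [← hW', ← hBp']; omega) (by simp only [← hW', ← hA', ← hBp']; omega)
  · exact basis_pair_fair_fat_of_two_planes_of_eight_le hG hd hk hs hl hfat hB₀ hD hne hR₁V hR₁2 hR₁3 hc₂V hc₃V
      hc₂ hc₃ hcover hnd₂ hnd₃ hB hnP hz hl0 hw₀ hx h8 hy₂.1 hy₂'.1 hy₃.1 hy₃'.1 hy₂y₂' hy₃y₃' hy₂.2.1 hy₂.2.2
      hy₂'.2.1 hy₂'.2.2 hy₃.2.1 hy₃.2.2 hy₃'.2.1 hy₃'.2.2

end PercRepro.Shadow
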